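import Mathlib
import HarnessLib
import Summits.ValiantsHypothesis.ValiantsHypothesis.Theorems.KPlusLogSqLawMixedGaugeLoewnerDownward

/-!
# Route «KPlusLogSqLaw», `WeakLifting` (stmt-ValiantsHypothesis-19561) — mixed-gauge series, what TWO FAST SPEEDS need: the Loewner matrix of
# `y ↦ y^{1+p}` (`0 < p < 1`) is CONDITIONALLY NEGATIVE SEMIDEFINITE — `Σᵢⱼ vᵢvⱼ K_{ij} ≤ 0` whenever `Σ vᵢ = 0`

HONEST FRAMING.  Helper file (hand leafhand-val-kpluslogsqlaw-1 g14, 2026-08-31; `--supports stmt-ValiantsHypothesis-19561 --as helper`,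
zero crux / stub credit).  After the two-class law at every ratio (p834386) and the several-slow-speeds law (p835068), the next cell of
lift-p4 g26's GAP NOTE (ii) is TWO FAST SPEEDS `b₀ < b₁`.  Dividing the block two-point identity by `s'^{b₀} − s^{b₀}` leaves, on the fast
side, `⟪q⁰,q⁰'⟫ + K_{jk}⟪q¹,q¹'⟫` with `K` the Loewner matrix of `y ↦ y^{r}`, `r = b₁/b₀ > 1`, at the nodes `Y = s^{b₀}`; a dependency
`Σ cⱼqⱼ = 0` puts each fast coordinate vector `(cⱼq¹ⱼ(l))ⱼ` in the hyperplane `Σ v = 0`, so the family downward law of the series survives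
verbatim PROVIDED `K` is non-positive on that hyperplane.  THIS FILE proves exactly that for `1 < r < 2` (`loewner_succ_form_nonpos`), in the
integral currency of the series: writing `y^{1+p}`'s divided difference as `K_{ij} = yⱼᵖ + yᵢ·L_{ij}` with `L` the (normalised) Loewner kernel of
`yᵖ` (`L_{ij}(yᵢ − yⱼ) = yᵢᵖ − yⱼᵖ`, `L_{ii} = p yᵢᵖ⁻¹`, so `K_{ij}(yᵢ − yⱼ) = yᵢ^{1+p} − yⱼ^{1+p}`, `K_{ii} = (1+p)yᵢᵖ`), one has for `Σ vᵢ = 0`: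
`Σᵢⱼ vᵢvⱼK_{ij} = Σᵢⱼ (vᵢyᵢ) L_{ij} vⱼ = c⁻¹∫₀^∞ tᵖ (Σ vᵢyᵢ/(t+yᵢ))(Σ vⱼ/(t+yⱼ)) dt = −c⁻¹∫₀^∞ t^{p−1} (Σ vᵢyᵢ/(t+yᵢ))² dt ≤ 0`
(`Σ vⱼ/(t+yⱼ) = −t⁻¹ Σ vⱼyⱼ/(t+yⱼ)` on the hyperplane).  [Bhatia–Sano 2009 (Loewner matrices of operator convex functions; `t^r`, `1 ≤ r ≤ 2`,
is conditionally negative definite); here an elementary Gram-integral proof.]  Consequence recorded in prose only (successor's bookkeeping,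
~600 l over p834999/p835032/p835068): with fast speeds all in `[b₀, 2b₀)` and slow speeds below `b₀`, `ζ ≤ n + 2m`.  Nothing here is about
`WeakLifting` / `TropicalB` in their windows, the registered stubs, the doors, `MatrixDescartes` (18050) or VP ≠ VNP.  No `def`; axioms standard.
-/

set_option linter.dupNamespace false
set_option autoImplicit false

namespace Summit.ValiantsHypothesis.ValiantsHypothesis.Theorems.KPlusLogSqLaw

namespace MixedGauge

open MeasureTheory Set Filter Real Matrix Finset
open scoped Topology BigOperators
open Summit.ValiantsHypothesis.ValiantsHypothesis.Theorems.KPlusLogSqLaw.TowerGraft.TwoSidedThree.Loewner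

/-- **Bilinear Gram integral of the Loewner kernel.**  `Σᵢⱼ xᵢ K_{ij} zⱼ = ∫₀^∞ tᵖ (Σᵢ xᵢ/(t+yᵢ))(Σⱼ zⱼ/(t+yⱼ)) dt`
(`K_{ij} = ∫₀^∞ tᵖ/((t+yᵢ)(t+yⱼ)) dt`, positive nodes, `0 < p < 1`). [folklore] -/
theorem loewnerForm_bilin_eq_integral {k : ℕ} (p : ℝ) (hp : p ∈ Set.Ioo (0:ℝ) 1) (y x z : Fin k → ℝ) (hy : ∀ i, 0 < y i) :
    (∑ i, ∑ l, x i * (∫ t in Ioi 0, t ^ p / ((t + y i) * (t + y l))) * z l)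
      = ∫ t in Ioi 0, t ^ p * ((∑ i, x i / (t + y i)) * (∑ l, z l / (t + y l))) := by
  have hint : ∀ i l, IntegrableOn (fun t : ℝ => t ^ p / ((t + y i) * (t + y l))) (Ioi 0) :=
    fun i l => integrableOn_kernel p (y i) (y l) hp (hy i) (hy l)
  have hswap : (∑ i, ∑ l, x i * (∫ t in Ioi 0, t ^ p / ((t + y i) * (t + y l))) * z l)
      = ∫ t in Ioi 0, ∑ i, ∑ l, x i * (t ^ p / ((t + y i) * (t + y l))) * z l := by
    rw [integral_finsetSum _ fun i _ => ?_]
    · refine Finset.sum_congr rfl fun i _ => ?_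
      rw [integral_finsetSum _ fun l _ => ?_]
      · refine Finset.sum_congr rfl fun l _ => ?_
        rw [integral_mul_const, integral_const_mul]
      · exact ((hint i l).const_mul (x i)).mul_const (z l)
    · exact integrable_finsetSum _ fun l _ => ((hint i l).const_mul (x i)).mul_const (z l)
  rw [hswap]
  refine setIntegral_congr_fun measurableSet_Ioi fun t ht => ?_
  have ht' : (0:ℝ) < t := ht
  have hden : ∀ i, t + y i ≠ 0 := fun i => by have := hy i; linarith
  rw [Finset.sum_mul_sum, Finset.mul_sum]
  refine Finset.sum_congr rfl fun i _ => ?_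
  rw [Finset.mul_sum]
  refine Finset.sum_congr rfl fun l _ => ?_
  have hi := hden i; have hl := hden l
  field_simp

/-- **THE LOEWNER MATRIX OF `y ↦ y^{1+p}` (`0 < p < 1`) IS CONDITIONALLY NEGATIVE SEMIDEFINITE.**  Positive nodes `yᵢ`, `c = ∫ rpowIntegrand₀₁ p · 1`,
`L_{ij} = c⁻¹∫₀^∞ tᵖ/((t+yᵢ)(t+yⱼ)) dt` (so `K_{ij} := yⱼᵖ + yᵢL_{ij}` is the divided difference of `y^{1+p}`: `K_{ij}(yᵢ − yⱼ) = yᵢ^{1+p} − yⱼ^{1+p}`,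
`K_{ii} = (1+p)yᵢᵖ`).  For every `v` with `Σ vᵢ = 0`: `Σᵢⱼ vᵢ K_{ij} vⱼ ≤ 0`. [Bhatia–Sano 2009; folklore Gram integral] -/
theorem loewner_succ_form_nonpos {k : ℕ} (p : ℝ) (hp : p ∈ Set.Ioo (0:ℝ) 1) (y v : Fin k → ℝ) (hy : ∀ i, 0 < y i)
    (hv : ∑ i, v i = 0) :
    ∑ i, ∑ l, v i * (y l ^ p + y i * ((∫ t in Ioi 0, rpowIntegrand₀₁ p t 1)⁻¹ *
        ∫ t in Ioi 0, t ^ p / ((t + y i) * (t + y l)))) * v l ≤ 0 := by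
  set c₀ : ℝ := ∫ t in Ioi 0, rpowIntegrand₀₁ p t 1 with hc₀def
  have hc₀ : 0 < c₀ := integral_rpowIntegrand₀₁_one_pos hp
  -- split the form: the `yⱼᵖ` part dies on the hyperplane, the rest is a bilinear Gram integral
  have hsplit : ∑ i, ∑ l, v i * (y l ^ p + y i * (c₀⁻¹ * ∫ t in Ioi 0, t ^ p / ((t + y i) * (t + y l)))) * v l
      = (∑ i, v i) * (∑ l, y l ^ p * v l)
        + c₀⁻¹ * ∑ i, ∑ l, (v i * y i) * (∫ t in Ioi 0, t ^ p / ((t + y i) * (t + y l))) * v l := by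
    rw [Finset.sum_mul, Finset.mul_sum, ← Finset.sum_add_distrib]
    refine Finset.sum_congr rfl fun i _ => ?_
    rw [Finset.mul_sum, Finset.mul_sum, ← Finset.sum_add_distrib]
    refine Finset.sum_congr rfl fun l _ => ?_
    ring
  rw [hsplit, hv, zero_mul, zero_add, loewnerForm_bilin_eq_integral p hp y (fun i => v i * y i) v hy]
  -- pointwise: tᵖ (Σ vᵢyᵢ/(t+yᵢ)) (Σ vⱼ/(t+yⱼ)) = − t^{p} t⁻¹ (Σ vᵢyᵢ/(t+yᵢ))²
  have hpt : ∀ t ∈ Ioi (0:ℝ), t ^ p * ((∑ i, v i * y i / (t + y i)) * (∑ l, v l / (t + y l)))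
      = -(t ^ p * t⁻¹ * (∑ i, v i * y i / (t + y i)) ^ 2) := by
    intro t ht
    have ht' : (0:ℝ) < t := ht
    have hden : ∀ i, t + y i ≠ 0 := fun i => by have := hy i; linarith
    have hkey : ∑ l, v l / (t + y l) = -(t⁻¹ * ∑ l, v l * y l / (t + y l)) := by
      have hterm : ∀ l, v l / (t + y l) = t⁻¹ * v l - t⁻¹ * (v l * y l / (t + y l)) := by
        intro l
        have hl := hden l
        field_simp
        ring
      simp_rw [hterm]
      rw [Finset.sum_sub_distrib, ← Finset.mul_sum, ← Finset.mul_sum, hv, mul_zero, zero_sub]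
    rw [hkey]
    ring
  rw [setIntegral_congr_fun measurableSet_Ioi hpt, integral_neg]
  have hnn : 0 ≤ ∫ t in Ioi (0:ℝ), t ^ p * t⁻¹ * (∑ i, v i * y i / (t + y i)) ^ 2 :=
    setIntegral_nonneg measurableSet_Ioi fun t ht => by
      have ht' : (0:ℝ) < t := ht
      have h1 : 0 ≤ t ^ p := Real.rpow_nonneg ht'.le _
      have h2 : 0 ≤ t⁻¹ := inv_nonneg.mpr ht'.le
      positivity
  have := mul_nonneg (inv_nonneg.mpr hc₀.le) hnn
  linarith

/-- the divided-difference identities behind the name: with `L_{ij} = c⁻¹∫ tᵖ/((t+yᵢ)(t+yⱼ))`, the kernel `K_{ij} = yⱼᵖ + yᵢL_{ij}` satisfies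
`K_{ij}·(yᵢ − yⱼ) = yᵢ·yᵢᵖ − yⱼ·yⱼᵖ` and `K_{ii} = (1+p)·yᵢᵖ` — the Loewner matrix of `y ↦ y·yᵖ = y^{1+p}`. [folklore] -/
theorem loewner_succ_entries {k : ℕ} (p : ℝ) (hp : p ∈ Set.Ioo (0:ℝ) 1) (y : Fin k → ℝ) (hy : ∀ i, 0 < y i) (i l : Fin k) :
    (y l ^ p + y i * ((∫ t in Ioi 0, rpowIntegrand₀₁ p t 1)⁻¹ * ∫ t in Ioi 0, t ^ p / ((t + y i) * (t + y l)))) * (y i - y l)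
        = y i * y i ^ p - y l * y l ^ p ∧
      (y i ^ p + y i * ((∫ t in Ioi 0, rpowIntegrand₀₁ p t 1)⁻¹ * ∫ t in Ioi 0, t ^ p / ((t + y i) * (t + y i))))
        = (1 + p) * y i ^ p := by
  set c₀ : ℝ := ∫ t in Ioi 0, rpowIntegrand₀₁ p t 1 with hc₀def
  have hc₀ : 0 < c₀ := integral_rpowIntegrand₀₁_one_pos hp
  constructor
  · have hK := integral_kernel_mul_sub p (y i) (y l) hp (hy i) (hy l)
    rw [← hc₀def] at hK
    have hL : c₀⁻¹ * (∫ t in Ioi 0, t ^ p / ((t + y i) * (t + y l))) * (y i - y l) = y i ^ p - y l ^ p := by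
      rw [mul_assoc, hK, ← mul_assoc, inv_mul_cancel₀ (ne_of_gt hc₀), one_mul]
    calc (y l ^ p + y i * (c₀⁻¹ * ∫ t in Ioi 0, t ^ p / ((t + y i) * (t + y l)))) * (y i - y l)
        = y l ^ p * (y i - y l) + y i * (c₀⁻¹ * (∫ t in Ioi 0, t ^ p / ((t + y i) * (t + y l))) * (y i - y l)) := by ring
      _ = y l ^ p * (y i - y l) + y i * (y i ^ p - y l ^ p) := by rw [hL]
      _ = y i * y i ^ p - y l * y l ^ p := by ring
  · have hL : c₀⁻¹ * (∫ t in Ioi 0, t ^ p / ((t + y i) * (t + y i))) = p * y i ^ (p - 1) := by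
      rw [integral_kernel_diag p (y i) hp (hy i), ← hc₀def, ← mul_assoc, inv_mul_cancel₀ (ne_of_gt hc₀), one_mul]
    rw [hL]
    have hy1 : y i * y i ^ (p - 1) = y i ^ p := by
      rw [Real.rpow_sub_one (ne_of_gt (hy i)), mul_div_assoc', mul_div_cancel_left₀ _ (ne_of_gt (hy i))]
    calc y i ^ p + y i * (p * y i ^ (p - 1)) = y i ^ p + p * (y i * y i ^ (p - 1)) := by ring
      _ = (1 + p) * y i ^ p := by rw [hy1]; ring

end MixedGauge

end Summit.ValiantsHypothesis.ValiantsHypothesis.Theorems.KPlusLogSqLaw
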